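import Summits.ValiantsHypothesis.ValiantsHypothesis.Theorems.LacunarySymmetroidMatrixDescartesDoorA26WallBubblingMomentTail
import Summits.ValiantsHypothesis.ValiantsHypothesis.Theorems.LacunarySymmetroidMatrixDescartesDoorA26WallBubblingMomentTower
import Summits.ValiantsHypothesis.ValiantsHypothesis.Theorems.LacunarySymmetroidMatrixDescartesDoorA26WallBubblingMomentClassLimit
import Summits.ValiantsHypothesis.ValiantsHypothesis.Theorems.LacunarySymmetroidMatrixDescartesDoorA26WallBubblingWeylQuadClasses
import Summits.ValiantsHypothesis.ValiantsHypothesis.Theorems.LacunarySymmetroidMatrixDescartesDoorA26WallBubblingWeylQuadDichotomy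
import Summits.ValiantsHypothesis.ValiantsHypothesis.Theorems.LacunarySymmetroidMatrixDescartesDoorA26WallBubblingWeylQuadSlots
import Summits.ValiantsHypothesis.ValiantsHypothesis.Theorems.LacunarySymmetroidMatrixDescartesDoorA26WallBubblingConfluentTower

/-!
# Wall bubbling for `DoorA26` — WEYL QUADRUPLES: THE FUNCTION-LEVEL LIMIT OF A CLUSTER AT THE STRATUM [4,1,1] and the DOOR-FREE single-cluster theorem

HONEST FRAMING.  Chain theorem toward `TripleStratum26` of `Cruxes/DoorA26/Lines/wall_bubbling_ConfluentDoor.lean` (rev 13; crux `DoorA26`,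
stmt-ValiantsHypothesis-19979 — OPEN, typed, never asserted), pattern [4,1,1] (the «∃ triple» binder covers a quadruple; chain `h411` of #91
`tripleStratum26_of_chains`).  W1 seat val-sym-door-p2 g15 (#97); the [4,1,1] clone of #89 `…WeylTripleLimit`, in the same FUNCTION-LEVEL
CLASS-MOMENT currency (#81–#83) with the size-free frame tail of #92 and the four-letter rigidity dichotomy of #94.  Positions: the quadruple at
`2,3,4,5` (`δ0 3 = δ0 4 = δ0 5 = δ0 2`), singles at `0,1`.

* **`weylQuadLimit`** — along a subsequence, normalised by the largest head moment (orders `< 10 / 4 / 1` of the ordered classes `(2,2)` / mixed /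
  pure), the genuine determinants converge CONTINUOUSLY WITH ALL DERIVATIVES to `g(s) = Σ_{k ∈ Fin 3 × Fin 3} (Σ_{m<n_k} c_{k,m}s^m/m!) e^{(δ0_{k₁}+δ0_{k₂})s}`
  with symmetric coefficients, one of them non-zero, and the RIGIDITY DICHOTOMY «`c_{(2,2),9} = 0` or every pure `c_{(x,y),0} = 0`» (#94).
* **`no_twenty_window_weylQuadruple`** — THE DOOR-FREE SINGLE-CLUSTER THEOREM at [4,1,1] (three 2-Sidon values): twenty zeros in a fixed window are
  impossible — `weylQuadLimit` + W2 `multiplicity_transfer_iteratedDeriv` + #96 `weylQuad_zerosWithMultiplicity_le`.  Why door-free: the quadruple's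
  class has TEN function-level slots but SEVEN Gram slots; the tenth is alive only when the frame Gram outgrows the function scale, and then #85's
  Schur identity on an invertible `3 × 3` minor kills every pure class.  The multi-cluster case and [4,2] are NOT treated.

Nothing here bears on `DoorA26`, `MatrixDescartes` (stmt-ValiantsHypothesis-18050) or `VP ≠ VNP`; `TripleStratum26`, (W), (M) OPEN.
`--supports stmt-ValiantsHypothesis-19979 --as helper`.  [this work].
-/

-- `Summit.ValiantsHypothesis.ValiantsHypothesis.…` repeats a component by the D-0017 layout
-- (single-conjunct summit), which the `dupNamespace` linter flags; the name is mandated.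
set_option linter.dupNamespace false

namespace Summit.ValiantsHypothesis.ValiantsHypothesis.Theorems.LacunarySymmetroidMatrixDescartes.WallBubbling

open Finset Filter Topology
open Bubbling (polar polar_apply)
open scoped BigOperators

/-- **THE FUNCTION-LEVEL LIMIT OF A CLUSTER AT A WEYL QUADRUPLE.**  See the module docstring. [this work] -/
theorem weylQuadLimit (δs : ℕ → Fin 6 → ℝ) (δ0 : Fin 6 → ℝ)
    (hδ : ∀ l, Tendsto (fun ν => δs ν l) atTop (𝓝 (δ0 l))) (h32 : δ0 3 = δ0 2) (h42 : δ0 4 = δ0 2) (h52 : δ0 5 = δ0 2)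
    (U : ℕ → Fin 6 → Matrix (Fin 2) (Fin 2) ℝ) (hU : ∀ ν l, (U ν l).IsSymm)
    (hne : ∀ ν, ∃ t, (∑ l, Real.exp (δs ν l * t) • U ν l).det ≠ 0) :
    ∃ φ : ℕ → ℕ, StrictMono φ ∧ ∃ (a : ℕ → ℝ) (c : Fin 3 × Fin 3 → ℕ → ℝ),
      (∀ k m, c k.swap m = c k m) ∧
      (∃ k m, m < (fun k : Fin 3 × Fin 3 => if k.1 = 2 ∧ k.2 = 2 then 10 else if k.1 = 2 ∨ k.2 = 2 then 4 else 1) k ∧ c k m ≠ 0) ∧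
      (c (2, 2) 9 = 0 ∨ ∀ k : Fin 3 × Fin 3, k.1 ≠ 2 → k.2 ≠ 2 → c k 0 = 0) ∧
      ∀ (j : ℕ) (ψ : ℕ → ℕ), StrictMono ψ → ∀ (ts : ℕ → ℝ) (t₀ : ℝ), Tendsto ts atTop (𝓝 t₀) →
        Tendsto (fun l => iteratedDeriv j (fun t => a (ψ l) * (∑ i, Real.exp (δs (φ (ψ l)) i * t) • U (φ (ψ l)) i).det) (ts l))
          atTop (𝓝 (iteratedDeriv j (fun s => ∑ k : Fin 3 × Fin 3,
            (∑ m ∈ Finset.range ((fun k : Fin 3 × Fin 3 => if k.1 = 2 ∧ k.2 = 2 then 10 else if k.1 = 2 ∨ k.2 = 2 then 4 else 1) k),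
              c k m * s ^ m / (m.factorial : ℝ))
              * Real.exp ((δ0 k.1.castSucc.castSucc.castSucc + δ0 k.2.castSucc.castSucc.castSucc) * s)) t₀)) := by
  classical
  -- ### notation
  set v : Fin 6 → Fin 3 := ![0, 1, 2, 2, 2, 2] with hv
  set cls : Fin 6 × Fin 6 → Fin 3 × Fin 3 := fun i => (v i.1, v i.2) with hcls
  set t6 : Fin 4 → Fin 6 := ![2, 3, 4, 5] with ht6
  set n : Fin 3 × Fin 3 → ℕ := fun k => if k.1 = 2 ∧ k.2 = 2 then 10 else if k.1 = 2 ∨ k.2 = 2 then 4 else 1 with hn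
  set e : ℕ → Fin 3 → ℝ := fun ν a => δs ν a.castSucc.castSucc.castSucc with he
  set η : ℕ → Fin 6 → ℝ := fun ν l => δs ν l - δs ν (v l).castSucc.castSucc.castSucc with hη
  set a : ℕ → Fin 6 × Fin 6 → ℝ := fun ν i => polar (U ν i.1) (U ν i.2) with ha
  set ε : ℕ → Fin 6 × Fin 6 → ℝ := fun ν i => η ν i.1 + η ν i.2 with hε
  set wν : ℕ → Fin 3 × Fin 3 → ℝ := fun ν k => e ν k.1 + e ν k.2 with hwν
  set w : Fin 3 × Fin 3 → ℝ := fun k => δ0 k.1.castSucc.castSucc.castSucc + δ0 k.2.castSucc.castSucc.castSucc with hw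
  set M : ℕ → Fin 3 × Fin 3 → ℕ → ℝ := fun ν k m => ∑ i, (if cls i = k then a ν i else 0) * ε ν i ^ m with hM
  set V : ℕ → Fin 4 → Matrix (Fin 2) (Fin 2) ℝ := fun ν p => U ν (t6 p) with hV
  set x : ℕ → Fin 4 → ℝ := fun ν p => η ν (t6 p) with hx
  set s : ℕ → ℝ := fun ν => |η ν 3| + |η ν 4| + |η ν 5| with hs
  have hn_le : ∀ k, n k ≤ 10 := by intro k; simp only [hn]; split_ifs <;> norm_num
  have hn_pos : ∀ k, 0 < n k := by intro k; simp only [hn]; split_ifs <;> norm_num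
  have hn_swap : ∀ k : Fin 3 × Fin 3, n k.swap = n k := by
    intro k; simp only [hn, Prod.fst_swap, Prod.snd_swap]
    by_cases h1 : k.1 = 2 <;> by_cases h2 : k.2 = 2 <;> simp [h1, h2]
  have hVsymm : ∀ ν p, (V ν p).IsSymm := fun ν p => hU ν _
  -- ### deviations
  have hη_cast : ∀ ν (b : Fin 3), η ν b.castSucc.castSucc.castSucc = 0 := fun ν b => weylQuad_eta_cast (δs ν) b
  have hs0 : ∀ ν, 0 ≤ s ν := fun ν => by positivity
  have hηle : ∀ ν l, |η ν l| ≤ s ν := by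
    intro ν l
    have h3 : |η ν 3| ≤ s ν := by simp only [hs]; linarith [abs_nonneg (η ν 4), abs_nonneg (η ν 5)]
    have h4 : |η ν 4| ≤ s ν := by simp only [hs]; linarith [abs_nonneg (η ν 3), abs_nonneg (η ν 5)]
    have h5 : |η ν 5| ≤ s ν := by simp only [hs]; linarith [abs_nonneg (η ν 3), abs_nonneg (η ν 4)]
    have h0 : ∀ b : Fin 3, |η ν b.castSucc.castSucc.castSucc| ≤ s ν := fun b => by rw [hη_cast, abs_zero]; exact hs0 ν
    rcases (show l = (0 : Fin 3).castSucc.castSucc.castSucc ∨ l = (1 : Fin 3).castSucc.castSucc.castSucc ∨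
        l = (2 : Fin 3).castSucc.castSucc.castSucc ∨ l = 3 ∨ l = 4 ∨ l = 5 by fin_cases l <;> decide) with h | h | h | h | h | h <;>
      rw [h] <;> first | exact h0 _ | exact h3 | exact h4 | exact h5
  have hxle : ∀ ν p, |x ν p| ≤ s ν := fun ν p => hηle ν (t6 p)
  have hεle : ∀ ν i, |ε ν i| ≤ 2 * s ν := by
    intro ν i
    calc |ε ν i| = |η ν i.1 + η ν i.2| := rfl
      _ ≤ |η ν i.1| + |η ν i.2| := abs_add_le _ _
      _ ≤ s ν + s ν := add_le_add (hηle ν _) (hηle ν _)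
      _ = 2 * s ν := by ring
  have hslim : Tendsto s atTop (𝓝 0) := by
    have h3 : Tendsto (fun ν => η ν 3) atTop (𝓝 0) := by
      have := (hδ 3).sub (hδ 2)
      rw [h32, sub_self] at this
      exact this
    have h4 : Tendsto (fun ν => η ν 4) atTop (𝓝 0) := by
      have := (hδ 4).sub (hδ 2)
      rw [h42, sub_self] at this
      exact this
    have h5 : Tendsto (fun ν => η ν 5) atTop (𝓝 0) := by
      have := (hδ 5).sub (hδ 2)
      rw [h52, sub_self] at this
      exact this
    have := ((continuous_abs.tendsto _ |>.comp h3).add (continuous_abs.tendsto _ |>.comp h4)).add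
      (continuous_abs.tendsto _ |>.comp h5)
    simpa [hs] using this
  have hxlim : ∀ p, Tendsto (fun ν => x ν p) atTop (𝓝 0) := by
    intro p
    refine squeeze_zero_norm (fun ν => ?_) hslim
    rw [Real.norm_eq_abs]; exact hxle ν p
  -- ### the class moments in frame language (#87, #84)
  have hM33 : ∀ ν m, M ν (2, 2) m = ∑ p, ∑ q, polar (V ν p) (V ν q) * (x ν p + x ν q) ^ m :=
    fun ν m => classMoment_quad (U ν) (η ν) m
  have hMa3 : ∀ ν (b : Fin 3), b ≠ 2 → ∀ m, M ν (b, 2) m = polar (U ν b.castSucc.castSucc.castSucc) (∑ q, x ν q ^ m • V ν q) := by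
    intro ν b hb m
    rw [show M ν (b, 2) m = _ from classMoment_mixed_left₄ (U ν) (η ν) m b hb, ← blockMixedMoment_eq_frame]
    refine Finset.sum_congr rfl fun q _ => ?_
    rw [hη_cast, zero_add]
  have hM3b : ∀ ν (b : Fin 3), b ≠ 2 → ∀ m, M ν (2, b) m = polar (∑ q, x ν q ^ m • V ν q) (U ν b.castSucc.castSucc.castSucc) := by
    intro ν b hb m
    rw [show M ν (2, b) m = _ from classMoment_mixed_right₄ (U ν) (η ν) m b hb, Bubbling.polar_comm, ← blockMixedMoment_eq_frame]
    refine Finset.sum_congr rfl fun q _ => ?_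
    rw [hη_cast, add_zero, Bubbling.polar_comm]
  have hMab : ∀ ν (b b' : Fin 3), b ≠ 2 → b' ≠ 2 → ∀ m,
      M ν (b, b') m = polar (U ν b.castSucc.castSucc.castSucc) (U ν b'.castSucc.castSucc.castSucc) * (0 : ℝ) ^ m := by
    intro ν b b' hb hb' m
    rw [show M ν (b, b') m = _ from classMoment_pure₄ (U ν) (η ν) m b b' hb hb', hη_cast, hη_cast, add_zero]
  have hMswap : ∀ ν k m, M ν k.swap m = M ν k m := fun ν k m => classMoment_swap₄ (U ν) (η ν) m k
  -- ### the moment tails (#81), for levels with `2 s ≤ 1/2`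
  obtain ⟨C6, hC6₀, hC6⟩ := momentTail 10
  obtain ⟨C3, hC3₀, hC3⟩ := momentTail 4
  set Ct : ℝ := max C6 C3 with hCt
  have htail_lvl : ∀ ν, 2 * s ν ≤ 1 / 2 → ∀ k m, n k ≤ m →
      |M ν k m| ≤ Ct * (2 * s ν) * ∑ j ∈ Finset.range (n k), |M ν k j| := by
    intro ν hsν k m hm
    have h2s : 0 ≤ 2 * s ν := by positivity
    obtain ⟨k1, k2⟩ := k
    by_cases h1 : k1 = 2 <;> by_cases h2 : k2 = 2
    · -- the quadruple's class: ten weighted members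
      subst h1; subst h2
      have hn6 : n (2, 2) = 10 := by simp [hn]
      rw [hn6] at hm ⊢
      have key := hC6 (univ.filter fun pq : Fin 4 × Fin 4 => pq.1 ≤ pq.2) (by decide)
        (fun pq => (if pq.1 = pq.2 then 1 else 2) * polar (V ν pq.1) (V ν pq.2)) (fun pq => x ν pq.1 + x ν pq.2) (2 * s ν) h2s hsν
        (fun pq _ => (abs_add_le _ _).trans (by linarith [hxle ν pq.1, hxle ν pq.2])) m hm
      simp only [hM33, quadMoment_symmetrise]
      refine key.trans ?_
      gcongr
      exact le_max_left _ _
    · subst h1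
      have hn3 : n (2, k2) = 4 := by simp [hn, h2]
      rw [hn3] at hm ⊢
      have key := hC3 (univ : Finset (Fin 4)) (by simp)
        (fun q => polar (V ν q) (U ν k2.castSucc.castSucc.castSucc)) (fun q => x ν q) (2 * s ν) h2s hsν
        (fun q _ => (hxle ν q).trans (by linarith [hs0 ν])) m hm
      have hrew : ∀ j, M ν (2, k2) j = ∑ q, polar (V ν q) (U ν k2.castSucc.castSucc.castSucc) * x ν q ^ j := by
        intro j
        rw [show M ν (2, k2) j = _ from classMoment_mixed_right₄ (U ν) (η ν) j k2 h2]
        refine Finset.sum_congr rfl fun q _ => ?_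
        rw [hη_cast, add_zero]
      simp only [hrew]
      refine key.trans ?_
      gcongr
      exact le_max_right _ _
    · subst h2
      have hn3 : n (k1, 2) = 4 := by simp [hn, h1]
      rw [hn3] at hm ⊢
      have key := hC3 (univ : Finset (Fin 4)) (by simp)
        (fun q => polar (U ν k1.castSucc.castSucc.castSucc) (V ν q)) (fun q => x ν q) (2 * s ν) h2s hsν
        (fun q _ => (hxle ν q).trans (by linarith [hs0 ν])) m hm
      have hrew : ∀ j, M ν (k1, 2) j = ∑ q, polar (U ν k1.castSucc.castSucc.castSucc) (V ν q) * x ν q ^ j := by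
        intro j
        rw [show M ν (k1, 2) j = _ from classMoment_mixed_left₄ (U ν) (η ν) j k1 h1]
        refine Finset.sum_congr rfl fun q _ => ?_
        rw [hη_cast, zero_add]
      simp only [hrew]
      refine key.trans ?_
      gcongr
      exact le_max_right _ _
    · have hn1 : n (k1, k2) = 1 := by simp [hn, h1, h2]
      rw [hn1] at hm ⊢
      rw [hMab ν k1 k2 h1 h2, zero_pow (by omega), mul_zero, abs_zero]
      positivity
  -- ### the scale: the largest head moment, indexed by `D = (Fin 3 × Fin 3) × Fin 10`
  set M' : ℕ → (Fin 3 × Fin 3) × Fin 10 → ℝ := fun ν d => if (d.2 : ℕ) < n d.1 then M ν d.1 d.2 else 0 with hM'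
  set N : ℕ → ℝ := fun ν => (univ : Finset ((Fin 3 × Fin 3) × Fin 10)).sup' Finset.univ_nonempty (fun d => |M' ν d|) with hN
  have hdom : ∀ ν d, |M' ν d| ≤ N ν := fun ν d => Finset.le_sup' (fun d => |M' ν d|) (Finset.mem_univ d)
  have hatt : ∀ ν, ∃ d, |M' ν d| = N ν := by
    intro ν
    obtain ⟨d, _, h⟩ := Finset.exists_mem_eq_sup' (Finset.univ_nonempty (α := (Fin 3 × Fin 3) × Fin 10)) (fun d => |M' ν d|)
    exact ⟨d, h.symm⟩
  have hN0 : ∀ ν, 0 ≤ N ν := fun ν => (abs_nonneg _).trans (hdom ν ((0, 0), 0))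
  have hheadN : ∀ ν k m, m < n k → |M ν k m| ≤ N ν := by
    intro ν k m hm
    have hm6 : m < 10 := lt_of_lt_of_le hm (hn_le k)
    have := hdom ν (k, ⟨m, hm6⟩)
    simp only [hM', hm, if_true] at this
    exact this
  -- ### positivity of the scale at levels with `2 s ≤ 1/2` (all moments vanish ⇒ the pencil determinant vanishes identically)
  have hNpos : ∀ ν, 2 * s ν ≤ 1 / 2 → 0 < N ν := by
    intro ν hsν
    rcases (hN0 ν).lt_or_eq with h | h
    · exact h
    exfalso
    have hhead0 : ∀ k m, m < n k → M ν k m = 0 := by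
      intro k m hm; have := hheadN ν k m hm; rw [← h] at this; exact abs_eq_zero.mp (le_antisymm this (abs_nonneg _))
    have hall0 : ∀ k m, M ν k m = 0 := by
      intro k m
      by_cases hm : m < n k
      · exact hhead0 k m hm
      · have ht := htail_lvl ν hsν k m (not_lt.mp hm)
        have hS : ∑ j ∈ Finset.range (n k), |M ν k j| = 0 :=
          Finset.sum_eq_zero fun j hj => by rw [hhead0 k j (Finset.mem_range.mp hj), abs_zero]
        rw [hS, mul_zero] at ht
        exact abs_eq_zero.mp (le_antisymm ht (abs_nonneg _))
    -- every class function vanishes, hence the determinant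
    obtain ⟨t, ht⟩ := hne ν
    apply ht
    rw [weylQuad_det_eq_memberSum]
    have hident := iteratedDeriv_normalisedSum_eq_classes cls (a ν) (ε ν) (wν ν) 1 0 t
    rw [iteratedDeriv_zero] at hident
    have hfun : (∑ i : Fin 6 × Fin 6, polar (U ν i.1) (U ν i.2) *
        Real.exp (((δs ν ((v i.1).castSucc.castSucc.castSucc) + δs ν ((v i.2).castSucc.castSucc.castSucc))
          + ((δs ν i.1 - δs ν ((v i.1).castSucc.castSucc.castSucc)) + (δs ν i.2 - δs ν ((v i.2).castSucc.castSucc.castSucc)))) * t))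
        = (∑ i, a ν i * Real.exp ((wν ν (cls i) + ε ν i) * t)) / 1 := by
      rw [div_one]
    rw [hfun, hident]
    refine Finset.sum_eq_zero fun k _ => ?_
    rw [Finset.sum_range_one, div_one]
    have hser := hasSum_momentSeries (fun i => if cls i = k then a ν i else 0) (ε ν) 0 t
    have hzero : (fun j : ℕ => (∑ i, (if cls i = k then a ν i else 0) * ε ν i ^ (0 + j)) * t ^ j / (j.factorial : ℝ)) = fun _ => 0 := by
      funext j; rw [zero_add, show (∑ i, (if cls i = k then a ν i else 0) * ε ν i ^ j) = M ν k j from rfl, hall0 k j]; simp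
    rw [hzero] at hser
    have h0 : ∑ i, (if cls i = k then a ν i else 0) * ε ν i ^ 0 * Real.exp (ε ν i * t) = 0 := hser.unique hasSum_zero
    rw [h0, mul_zero, mul_zero]
  -- ### shift to levels with `2 s ≤ 1/2`, then ONE compactness extraction
  obtain ⟨ν₀, hν₀⟩ : ∃ ν₀, ∀ ν, ν₀ ≤ ν → 2 * s ν ≤ 1 / 2 := by
    have h2s : Tendsto (fun ν => 2 * s ν) atTop (𝓝 0) := by simpa using hslim.const_mul 2
    have hev : ∀ᶠ ν in atTop, 2 * s ν ≤ 1 / 2 := h2s.eventually (Iic_mem_nhds (by norm_num : (0 : ℝ) < 1 / 2))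
    exact eventually_atTop.mp hev
  obtain ⟨φ₁, hφ₁, cD, hcD, -, ⟨d₁, hd₁⟩⟩ := levelSelection_multi (fun l d => M' (l + ν₀) d) (fun l => N (l + ν₀))
    (fun l => hNpos _ (hν₀ _ (Nat.le_add_left _ _))) (fun l d => hdom _ d) (fun l => hatt _)
  set φ : ℕ → ℕ := fun l => φ₁ l + ν₀ with hφ
  have hφmono : StrictMono φ := fun a b hab => by simp only [hφ]; exact Nat.add_lt_add_right (hφ₁ hab) _
  have hφge : ∀ l, ν₀ ≤ φ l := fun l => Nat.le_add_left _ _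
  have hφtop : Tendsto φ atTop atTop := hφmono.tendsto_atTop
  have hNφ : ∀ l, 0 < N (φ l) := fun l => hNpos _ (hν₀ _ (hφge l))
  -- the limit coefficients
  set c : Fin 3 × Fin 3 → ℕ → ℝ := fun k m => if h : m < 10 then cD (k, ⟨m, h⟩) else 0 with hc
  have hmom : ∀ k m, m < n k → Tendsto (fun l => M (φ l) k m / N (φ l)) atTop (𝓝 (c k m)) := by
    intro k m hm
    have hm6 : m < 10 := lt_of_lt_of_le hm (hn_le k)
    have h := hcD (k, ⟨m, hm6⟩)
    simp only [hM', hm, if_true] at h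
    simp only [hc, hm6, dif_pos]
    exact h
  -- symmetry of the limit coefficients
  have hcsymm : ∀ k m, c k.swap m = c k m := by
    intro k m
    by_cases hm6 : m < 10
    · simp only [hc, hm6, dif_pos]
      have h1 := hcD (k.swap, ⟨m, hm6⟩)
      have h2 := hcD (k, ⟨m, hm6⟩)
      have heq : (fun l => M' (φ₁ l + ν₀) (k.swap, ⟨m, hm6⟩) / N (φ₁ l + ν₀)) = fun l => M' (φ₁ l + ν₀) (k, ⟨m, hm6⟩) / N (φ₁ l + ν₀) := by
        funext l; simp only [hM', hn_swap, hMswap]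
      rw [heq] at h1
      exact tendsto_nhds_unique h1 h2
    · simp only [hc, hm6, dif_neg, not_false_eq_true]
  -- one coefficient is non-zero
  have hcne : ∃ k m, m < n k ∧ c k m ≠ 0 := by
    obtain ⟨k, m⟩ := d₁
    refine ⟨k, m, ?_, ?_⟩
    · by_contra hm
      have hz : ∀ l, M' (φ₁ l + ν₀) (k, m) / N (φ₁ l + ν₀) = 0 := by
        intro l; simp only [hM', hm, if_false, zero_div]
      have h := hcD (k, m)
      rw [show (fun l => M' (φ₁ l + ν₀) (k, m) / N (φ₁ l + ν₀)) = fun _ => (0 : ℝ) from funext hz] at h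
      have := tendsto_nhds_unique h tendsto_const_nhds
      rw [this, abs_zero] at hd₁; exact zero_ne_one hd₁
    · simp only [hc, m.isLt, dif_pos, Fin.eta]
      intro h0; rw [h0, abs_zero] at hd₁; exact zero_ne_one hd₁
  -- ### the class towers (#82) and the assembly (#83)
  have hclass : ∀ (k : Fin 3 × Fin 3) (r : ℕ) (ψ : ℕ → ℕ), StrictMono ψ → ∀ (R : ℝ) (t : ℕ → ℝ) (t₀ : ℝ), (∀ l, |t l| ≤ R) →
      Tendsto t atTop (𝓝 t₀) →
      Tendsto (fun l => (∑ i, (if cls i = k then a (φ (ψ l)) i else 0) * ε (φ (ψ l)) i ^ r * Real.exp (ε (φ (ψ l)) i * t l))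
        / N (φ (ψ l))) atTop (𝓝 (∑ m ∈ Finset.range (n k - r), c k (r + m) * t₀ ^ m / (m.factorial : ℝ))) := by
    intro k r ψ hψ R t t₀ htR htlim
    refine momentTower_limit (n k) (fun l i => if cls i = k then a (φ l) i else 0) (fun l => ε (φ l)) (fun l => N (φ l))
      (fun l => Ct * (2 * s (φ l)) * 10) (c k) hNφ (fun m hm => hmom k m hm) ?_ ?_ r ψ hψ R t t₀ htR htlim
    · intro l m hm
      have h := htail_lvl (φ l) (hν₀ _ (hφge l)) k m hm
      refine h.trans ?_
      have hS : ∑ j ∈ Finset.range (n k), |M (φ l) k j| ≤ 10 * N (φ l) := by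
        calc ∑ j ∈ Finset.range (n k), |M (φ l) k j| ≤ ∑ _j ∈ Finset.range (n k), N (φ l) :=
              Finset.sum_le_sum fun j hj => hheadN _ k j (Finset.mem_range.mp hj)
          _ ≤ ∑ _j ∈ Finset.range 10, N (φ l) :=
              Finset.sum_le_sum_of_subset_of_nonneg (Finset.range_subset_range.mpr (hn_le k)) fun _ _ _ => hN0 _
          _ = 10 * N (φ l) := by rw [Finset.sum_const, Finset.card_range, nsmul_eq_mul]; norm_num
      have hCt0 : 0 ≤ Ct * (2 * s (φ l)) := mul_nonneg (le_trans hC6₀ (le_max_left _ _)) (by positivity)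
      calc Ct * (2 * s (φ l)) * ∑ j ∈ Finset.range (n k), |M (φ l) k j| ≤ Ct * (2 * s (φ l)) * (10 * N (φ l)) := by gcongr
        _ = Ct * (2 * s (φ l)) * 10 * N (φ l) := by ring
    · have := (hslim.comp hφtop).const_mul (Ct * 2) |>.mul_const 10
      simp only [mul_zero, zero_mul] at this
      refine this.congr fun l => ?_
      simp only [Function.comp_apply]; ring
  have hwlim : ∀ k, Tendsto (fun l => wν (φ l) k) atTop (𝓝 (w k)) :=
    fun k => ((hδ _).comp hφtop).add ((hδ _).comp hφtop)
  have hconv := classLimit_iteratedDeriv cls (fun l => a (φ l)) (fun l => ε (φ l)) (fun l => wν (φ l)) w (fun l => N (φ l)) n c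
    hwlim hclass
  -- ### the rigidity dichotomy (#88)
  have hdich : c (2, 2) 9 = 0 ∨ ∀ k : Fin 3 × Fin 3, k.1 ≠ 2 → k.2 ≠ 2 → c k 0 = 0 := by
    by_contra hcon
    push Not at hcon
    obtain ⟨hc5, ⟨⟨b, b'⟩, hb, hb', hcd⟩⟩ := hcon
    refine weylQuad_dichotomy (fun l => V (φ l)) (fun l p => hVsymm _ p) (fun l => x (φ l)) (fun p => (hxlim p).comp hφtop)
      (fun l => U (φ l) b.castSucc.castSucc.castSucc) (fun l => U (φ l) b'.castSucc.castSucc.castSucc) (fun l => hU _ _) (fun l => hU _ _)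
      (fun l => N (φ l)) hNφ ?_ (c (2, 2) 9) hc5 ?_ ?_ ?_ (c (b, b') 0) hcd ?_
    · intro l m hm
      rw [← hM33]; exact hheadN _ (2, 2) m (by simp only [hn, and_self, if_true]; omega)
    · have h := hmom (2, 2) 9 (by simp [hn])
      exact h.congr fun l => by rw [hM33]
    · intro l m hm
      rw [← hMa3 _ b hb]; exact hheadN _ (b, 2) m (by simp only [hn, hb, false_and, if_false, or_true, if_true]; omega)
    · intro l m hm
      rw [← hM3b _ b' hb']; exact hheadN _ (2, b') m (by simp only [hn, hb', and_false, if_false, true_or, if_true]; omega)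
    · have h := hmom (b, b') 0 (hn_pos _)
      exact h.congr fun l => by rw [hMab _ b b' hb hb', pow_zero, mul_one]
  -- ### conclusion
  refine ⟨φ, hφmono, fun l => (N (φ l))⁻¹, c, hcsymm, hcne, hdich, ?_⟩
  intro j ψ hψ ts t₀ hts
  -- a convergent sequence of times is bounded
  obtain ⟨R, hR⟩ : ∃ R, ∀ l, |ts l| ≤ R := by
    obtain ⟨R, hR⟩ := (Metric.isBounded_range_of_tendsto ts hts).subset_closedBall (0 : ℝ)
    exact ⟨R, fun l => by simpa [Real.dist_eq] using hR (Set.mem_range_self l)⟩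
  have h := hconv j ψ hψ R ts t₀ hR hts
  have hfun : ∀ l, (fun t => (N (φ (ψ l)))⁻¹ * (∑ i, Real.exp (δs (φ (ψ l)) i * t) • U (φ (ψ l)) i).det)
      = fun s' => (∑ i, a (φ (ψ l)) i * Real.exp ((wν (φ (ψ l)) (cls i) + ε (φ (ψ l)) i) * s')) / N (φ (ψ l)) := by
    intro l; funext s'
    rw [weylQuad_det_eq_memberSum, div_eq_inv_mul]
  simp only [hfun]
  exact h

/-- **NO TWENTY IN A WINDOW AT A VALUE-GENERIC WEYL QUADRUPLE (stratum [4,1,1]) — NO DOOR.**  Positions: quadruple at `2,3,4,5`, simple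
values at `0,1`; the three values `δ0 0, δ0 1, δ0 2` are 2-Sidon. [this work] -/
theorem no_twenty_window_weylQuadruple
    (δs : ℕ → Fin 6 → ℝ) (δ0 : Fin 6 → ℝ) (hδ : ∀ l, Tendsto (fun ν => δs ν l) atTop (𝓝 (δ0 l)))
    (h32 : δ0 3 = δ0 2) (h42 : δ0 4 = δ0 2) (h52 : δ0 5 = δ0 2)
    (hvg : ∀ a b c d : Fin 3, δ0 a.castSucc.castSucc.castSucc + δ0 b.castSucc.castSucc.castSucc
        = δ0 c.castSucc.castSucc.castSucc + δ0 d.castSucc.castSucc.castSucc → (a = c ∧ b = d) ∨ (a = d ∧ b = c))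
    (U : ℕ → Fin 6 → Matrix (Fin 2) (Fin 2) ℝ) (hU : ∀ ν l, (U ν l).IsSymm)
    (hne : ∀ ν, ∃ t, (∑ l, Real.exp (δs ν l * t) • U ν l).det ≠ 0)
    (A B : ℝ) (hz : ∀ ν, ∃ z : Fin 20 → ℝ, StrictMono z ∧ ∀ i, z i ∈ Set.Icc A B ∧ (∑ l, Real.exp (δs ν l * z i) • U ν l).det = 0) :
    False := by
  obtain ⟨φ, _, a, c, hsymm, hcne, hdich, hconv⟩ := weylQuadLimit δs δ0 hδ h32 h42 h52 U hU hne
  obtain ⟨Z, m, hZ, h20⟩ := multiplicity_transfer_iteratedDeriv A B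
    (fun k t => a k * (∑ l, Real.exp (δs (φ k) l * t) • U (φ k) l).det)
    (fun s => ∑ k : Fin 3 × Fin 3,
      (∑ m ∈ Finset.range ((fun k : Fin 3 × Fin 3 => if k.1 = 2 ∧ k.2 = 2 then 10 else if k.1 = 2 ∨ k.2 = 2 then 4 else 1) k),
        c k m * s ^ m / (m.factorial : ℝ)) * Real.exp ((δ0 k.1.castSucc.castSucc.castSucc + δ0 k.2.castSucc.castSucc.castSucc) * s))
    (fun k n => contDiff_const.mul (contDiff_pencilDet _ _ n))
    (fun j _ ψ hψ t t₀ _ ht => hconv j ψ hψ t t₀ ht)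
    (fun k => by
      obtain ⟨z, hz1, hz2⟩ := hz (φ k)
      exact ⟨z, hz1, fun i => ⟨(hz2 i).1, by rw [(hz2 i).2, mul_zero]⟩⟩)
  have h19 := weylQuad_zerosWithMultiplicity_le (fun b : Fin 3 => δ0 b.castSucc.castSucc.castSucc) hvg c hsymm hcne hdich Z m
    (fun z hz' => ⟨Set.mem_univ _, (hZ z hz').2⟩)
  have h19' : ∑ z ∈ Z, m z ≤ 19 := h19
  omega


end Summit.ValiantsHypothesis.ValiantsHypothesis.Theorems.LacunarySymmetroidMatrixDescartes.WallBubbling
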